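import Literature.NumberTheory.GaloisRepresentations.ContinuousShapiroLiftMackeyCup
import Literature.NumberTheory.GaloisRepresentations.ContinuousH1CoefficientTransport
import Literature.NumberTheory.GaloisRepresentations.ContinuousShapiroLiftCores
import Literature.NumberTheory.GaloisRepresentations.ContinuousShapiroLiftFunctor
import Literature.NumberTheory.GaloisRepresentations.CoinducedDiscreteGaloisModuleProofs
import HarnessLib

/-!
# Sketch (stub-ideation k2 g12, `stub_cmLambdaLower`): the SEMI-LOCAL SHAPIRO–MACKEY DICTIONARY, many orbits —
# the ARITHMETIC local term (N3) and the orbit data (N1) that card k3-g11 left open, plus the `H¹`-ISOMORPHISM and the count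

Crux `ResidualThetaCountLowerPureAtTwo` (stmt-BirchSwinnertonDyer-26074), stub `Bt26Lambda.stub_cmLambdaLower : RSL_g` (22608) BY NAME;
interior step S4₀ `hne` of item 7 (STUB-PLAN rev 15, S56 step (3): ONE `SelmerComplement` call per `(n,k)` over `K = ℚ` on
`Maps(Γ_ℚ ⧸ Γ_n, A_ρ[2^k])`).  Generic continuous group cohomology over the LANDED twisted comparison maps `Φ_c = resCoindFinHomR` of
`ContinuousShapiroLiftMackeyCup.lean` ((M), 2026-08-29) and, in §E, the tree's number-field `localTatePairing`.  For `θ : D →ₜ* G`,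
`N ⊴ G` open normal of finite index, `N_D = θ⁻¹N` and orbit data `c : ι → G ⧸ N` with `hbij : (i, y') ↦ ē(y')·c_i` bijective:

* §A (PROVED) `mackeyCoordEquiv : (Maps(G⧸N, X))|_θ ≃+ (ι → Maps(D⧸N_D, X|_θ))`, `F ↦ (Φ_{c_i} F)_i`, continuous both ways,
  `D`-equivariant (module Mackey; = card k3-g11 (B1) as an `AddEquiv` with topology).
* §B (PROVED) `mackeyCohomologyEquiv : H¹(D, (Maps(G⧸N, X))|_θ) ≃+ (ι → H¹(D, Maps(D⧸N_D, X|_θ)))` with coordinates `H¹(Φ_{c_i})`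
  (tree `cohomologyCoordEquiv` fed with §A): Mackey at `H¹` as an ISOMORPHISM — surjectivity (= k3-g11 R1) AND injectivity
  (`eq_zero_iff_forall_cohomologyMap_resCoindFinHomR`, new); with the local Shapiro bijection this is the literature's semi-local
  decomposition `H¹(K_v, Ind M) ≅ ⊕_{w ∣ v} H¹(L_w, M)` (`exists_eq_shapiroLift_family`); `cohomologyMap_resCoindFinHomR_map_id` bridges to (M) §3.
* §C (PROVED) the local Mackey cup formula for two ARBITRARY local classes, `z ∪_{(ΣP)|θ} z' = Σ_i H¹(Φ_{c_i}) z ∪_{Σ P|θ} H¹(Φ_{c_i}) z'`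
  (the local pairing is BLOCK-DIAGONAL in Mackey coordinates; k3-g11 R2 is the case `z = θ^*(Sh a)`, (M) §5 the case of two global lifts).
* §D (PROVED) the semi-local COUNT `#H¹(D, (Maps(G⧸N, X))|_θ) = ∏_i #H¹(N_D, X|_θ)` (`SemiLocalCount`, witness `semiLocalCount`).
* §E (PROVED, ARITHMETIC — k3-g11's N3 «S–M, NEW», delivered) `Arith.localTatePairing_coind_eq_sum_cupProduct_resCoindFinHomR`: for a number
  field `K`, a place `v`, `U ⊴ Γ_K` open normal of finite index, discrete modules `ρ, ρ'` with an equivariant `B : M × M' → μₙ` and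
  `Ψ = coindTateDualMor`: `⟨a', H¹(Ψ_v) t⟩_v = Σ_i H¹(Φ_{c_i}) a' ∪_{Σ_{U'} B_v} H¹(Φ_{c_i}) t` in `H²(K_v, μₙ)` — the MANY-ORBIT twin of the
  tree's one-orbit `localTatePairing_coind_cohomologyMap_eq_cupProduct_pull`, in exactly the currency `SelmerComplement`'s orthogonality sum speaks.
* §F (PROVED — k3-g11's N1 = STUB-PLAN rev 16 **Q68**, delivered) `bijective_of_orbitReps` (`hcov` + `hsep` ⟹ `hbij`), `exists_orbitReps`
  (`ι :=` the `D`-orbits, `c := Quotient.out`; `ι` in the universe of `G` as §B needs), `exists_orbitReps_bijective` (Q68's verbatim shape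
  `g : ι → G`, the `hbij` binder of p685176 / p685345), `card_mul_index_eq_of_orbitReps` (`#ι·[D:N_D] = [G:N]`, i.e. `Σ_{w∣v}[L_w:K_v] = [L:K]`).

`lean check`: rc 0, 0 errors, 0 sorries.  Nothing here proves BSD, RSL_g (22608) or (R≥)ᵖ (26074); no item is re-typed; no `_of`, cut or
HOLD text is touched.  References: [NeukirchSchmidtWingberg2008] I §5 (1.5.3)(iv), (1.5.6)–(1.5.7), I §6 (1.6.4)–(1.6.5); [MilneADT2006] I Cor. 2.3,
I §6 proof of Prop. 6.9; [Brown1982] III §5 (5.6)(b); [GreenbergLNM1716] §4 (`𝒫_E^{(v)}(F_n) = ∏_{v_n∣v} ℋ_E((F_n)_{v_n})`, pp. 106, 114 of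
[Coates–Greenberg–Ribet–Rubin LNM 1716]); Greenberg–Vatsal, Invent. Math. 142 (2000) §2 (doi:10.1007/s002220000080); [Delbourgo2008] p. 171.
-/

noncomputable section

open CategoryTheory

open scoped Classical

universe u v

-- the Cruxes namespace of this sub repeats the summit name by design (D-0017 nested layout)
set_option linter.dupNamespace false

namespace Summit.BirchSwinnertonDyer.BirchSwinnertonDyer.Cruxes.ResidualThetaCountLowerPureAtTwo.SideaK2G12

open Literature.NumberTheory.GaloisRepresentations _root_.TopRep

variable {R : Type u} [CommRing R] [TopologicalSpace R]
variable {G : Type v} [Group G] [TopologicalSpace G]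
variable {D : Type v} [Group D] [TopologicalSpace D]

/-! ## §A Mackey's decomposition at module level (H-SL1) -/

section ModuleLevel

variable (X : TopRep.{v} R G) (N : Subgroup G) [N.Normal] (θ : D →ₜ* G) {ι : Type v} (c : ι → G ⧸ N)
  (hbij : Function.Bijective fun q : ι × (D ⧸ N.comap (θ : D →* G)) => quotientMapOfHom N θ q.2 * c q.1)

/-- **H-SL1 — Mackey coordinates.** `F ↦ (Φ_{c_i} F)_i` is an additive bijection
`(Maps(G⧸N, X))|_θ ≃+ (ι → Maps(D⧸N_D, X|_θ))` when the `c_i` represent the `D`-orbits of `G ⧸ N`; the inverse reads a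
family `Ψ` back through the orbit bijection `e : ι × (D⧸N_D) ≃ G⧸N`, `y ↦ Ψ (e⁻¹ y).1 (e⁻¹ y).2`.
[cite: Brown1982, III §5 (5.6)(b)] [cite: NeukirchSchmidtWingberg2008, I §5 (1.5.6)–(1.5.7)] -/
def mackeyCoordEquiv :
    TopRep.res (θ : D →* G) (coindFin X N) ≃+ (ι → coindFin (TopRep.res (θ : D →* G) X) (N.comap (θ : D →* G))) where
  toFun F i := (resCoindFinHomR X N θ (c i)).hom F
  invFun Ψ := fun y => Ψ ((Equiv.ofBijective _ hbij).symm y).1 ((Equiv.ofBijective _ hbij).symm y).2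
  left_inv F := by
    funext y
    change F (quotientMapOfHom N θ ((Equiv.ofBijective _ hbij).symm y).2 * c ((Equiv.ofBijective _ hbij).symm y).1) = F y
    exact congrArg F ((Equiv.ofBijective _ hbij).apply_symm_apply y)
  right_inv Ψ := by
    funext i y'
    have h : (Equiv.ofBijective _ hbij).symm (quotientMapOfHom N θ y' * c i) = (i, y') :=
      (Equiv.ofBijective _ hbij).injective (by rw [Equiv.apply_symm_apply, Equiv.ofBijective_apply])
    change Ψ ((Equiv.ofBijective _ hbij).symm (quotientMapOfHom N θ y' * c i)).1
        ((Equiv.ofBijective _ hbij).symm (quotientMapOfHom N θ y' * c i)).2 = Ψ i y'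
    rw [h]
  map_add' F F' := funext fun i => map_add _ F F'

/-- Coordinates of `mackeyCoordEquiv`: the `i`-th one is `Φ_{c_i}`. [cite: Brown1982, III §5 (5.6)(b)] -/
@[simp]
theorem mackeyCoordEquiv_apply (F : TopRep.res (θ : D →* G) (coindFin X N)) (i : ι) :
    mackeyCoordEquiv X N θ c hbij F i = (resCoindFinHomR X N θ (c i)).hom F :=
  rfl

/-- `mackeyCoordEquiv` is continuous (each coordinate is the continuous map `Φ_{c_i}`). [cite: Brown1982, III §5 (5.6)(b)] -/
theorem continuous_mackeyCoordEquiv : Continuous (mackeyCoordEquiv X N θ c hbij) :=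
  continuous_pi fun i => (resCoindFinHomR X N θ (c i)).hom.continuous

/-- The inverse of `mackeyCoordEquiv` is continuous (product topologies; evaluation maps). [cite: Brown1982, III §5 (5.6)(b)] -/
theorem continuous_mackeyCoordEquiv_symm : Continuous (mackeyCoordEquiv X N θ c hbij).symm :=
  continuous_pi fun y =>
    (continuous_apply ((Equiv.ofBijective _ hbij).symm y).2).comp
      (continuous_apply ((Equiv.ofBijective _ hbij).symm y).1)

/-- `mackeyCoordEquiv` is `D`-equivariant coordinatewise (each `Φ_{c_i}` intertwines). [cite: Brown1982, III §5 (5.6)(b)] -/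
theorem mackeyCoordEquiv_ρ (d : D) (F : TopRep.res (θ : D →* G) (coindFin X N)) (i : ι) :
    mackeyCoordEquiv X N θ c hbij ((TopRep.res (θ : D →* G) (coindFin X N)).ρ d F) i =
      (coindFin (TopRep.res (θ : D →* G) X) (N.comap (θ : D →* G))).ρ d (mackeyCoordEquiv X N θ c hbij F i) :=
  TopRep.hom_comm_apply (resCoindFinHomR X N θ (c i)) d F

end ModuleLevel

/-! ## §B The semi-local decomposition of `H¹` (H-SL2) -/

section CohomologyLevel

variable [IsTopologicalGroup D]
variable (X : TopRep.{v} R G) (N : Subgroup G) [N.Normal] (θ : D →ₜ* G) {ι : Type v} (c : ι → G ⧸ N)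
  (hbij : Function.Bijective fun q : ι × (D ⧸ N.comap (θ : D →* G)) => quotientMapOfHom N θ q.2 * c q.1)

/-- **H-SL2 — Mackey at the level of `H¹`**: `H¹(D, (Maps(G⧸N, X))|_θ) ≃+ (ι → H¹(D, Maps(D⧸N_D, X|_θ)))`, the tree's
`cohomologyCoordEquiv` for the coordinate system of §A. [cite: NeukirchSchmidtWingberg2008, I §5 (1.5.6)–(1.5.7)]
[cite: SerreGaloisCohomology1997, I §2.2] -/
def mackeyCohomologyEquiv :
    continuousCohomology.{u, v, v} 1 (TopRep.res (θ : D →* G) (coindFin X N)) ≃+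
      (ι → continuousCohomology.{u, v, v} 1 (coindFin (TopRep.res (θ : D →* G) X) (N.comap (θ : D →* G)))) :=
  cohomologyCoordEquiv (X := coindFin (TopRep.res (θ : D →* G) X) (N.comap (θ : D →* G)))
    (X₁ := TopRep.res (θ : D →* G) (coindFin X N)) (mackeyCoordEquiv X N θ c hbij)
    (continuous_mackeyCoordEquiv X N θ c hbij) (continuous_mackeyCoordEquiv_symm X N θ c hbij)
    (mackeyCoordEquiv_ρ X N θ c hbij)

/-- The coordinates of `mackeyCohomologyEquiv` are the maps `H¹(Φ_{c_i})` (`cohomologyMap (resCoindFinHomR …) 1`).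
[cite: NeukirchSchmidtWingberg2008, I §5 (1.5.6)–(1.5.7)] -/
theorem mackeyCohomologyEquiv_apply (z : continuousCohomology.{u, v, v} 1 (TopRep.res (θ : D →* G) (coindFin X N))) (i : ι) :
    mackeyCohomologyEquiv X N θ c hbij z i = cohomologyMap (resCoindFinHomR X N θ (c i)) 1 z := by
  obtain ⟨φ, rfl⟩ := oneCocycleClass_surjective _ z
  unfold mackeyCohomologyEquiv
  rw [cohomologyCoordEquiv_apply, cohomologyCoord_oneCocycleClass, cohomologyMap_oneCocycleClass]
  exact congrArg _ (Subtype.ext (ContinuousMap.ext fun d => rfl))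

include hbij in
/-- **Surjectivity in the form the `SelmerComplement` step (S4₀ `hne`) consumes**: every family of local layer classes
`(t_i)_i`, `t_i ∈ H¹(D, Maps(D⧸N_D, X|_θ))`, is the family of Mackey coordinates of ONE class of the restricted coinduced
module. [cite: NeukirchSchmidtWingberg2008, I §5 (1.5.6)–(1.5.7)] -/
theorem exists_eq_cohomologyMap_resCoindFinHomR
    (t : ι → continuousCohomology.{u, v, v} 1 (coindFin (TopRep.res (θ : D →* G) X) (N.comap (θ : D →* G)))) :
    ∃ z : continuousCohomology.{u, v, v} 1 (TopRep.res (θ : D →* G) (coindFin X N)),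
      ∀ i, cohomologyMap (resCoindFinHomR X N θ (c i)) 1 z = t i := by
  obtain ⟨z, hz⟩ := (mackeyCohomologyEquiv X N θ c hbij).surjective t
  exact ⟨z, fun i => by rw [← mackeyCohomologyEquiv_apply X N θ c hbij, hz]⟩

include hbij in
/-- **Injectivity**: a class of the restricted coinduced module vanishes iff all its Mackey coordinates do.
[cite: NeukirchSchmidtWingberg2008, I §5 (1.5.6)–(1.5.7)] -/
theorem eq_zero_iff_forall_cohomologyMap_resCoindFinHomR
    (z : continuousCohomology.{u, v, v} 1 (TopRep.res (θ : D →* G) (coindFin X N))) :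
    z = 0 ↔ ∀ i, cohomologyMap (resCoindFinHomR X N θ (c i)) 1 z = 0 := by
  rw [← (mackeyCohomologyEquiv X N θ c hbij).map_eq_zero_iff, funext_iff]
  exact forall_congr' fun i => by rw [mackeyCohomologyEquiv_apply]; rfl

include hbij in
/-- **H-SL2′ — the SEMI-LOCAL SHAPIRO decomposition** `H¹(D, (Maps(G⧸N, X))|_θ) ≅ ⊕_{i} H¹(N_D, X|_θ)`: every family of
LAYER classes `a_i ∈ H¹(N_D, X|_θ)` is `(Sh_{N_D}^D)⁻¹` of the Mackey coordinates of one class (§B + `shapiroLift_surjective`);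
dictionary: `D = Γ_{ℚ_ℓ}`, `G = Γ_ℚ`, `N = Γ_{ℚ_n}`, `N_D = Γ_{ℚ_{n,𝔩}}`, `ι` = places of `ℚ_n` above `ℓ`, i.e. the literature's
`H¹(ℚ_ℓ, Ind M) = ⊕_{𝔩∣ℓ} H¹(ℚ_{n,𝔩}, M)`. [cite: NeukirchSchmidtWingberg2008, I §6 Prop. (1.6.4)] -/
theorem exists_eq_shapiroLift_family (hN : IsOpen (N : Set G))
    {sD : D ⧸ N.comap (θ : D →* G) → D} (hsD : ∀ y, (sD y : D ⧸ N.comap (θ : D →* G)) = y)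
    (hsD1 : sD ((1 : D) : D ⧸ N.comap (θ : D →* G)) = 1)
    (a : ι → continuousCohomology.{u, v, v} 1 (subgroupRep (TopRep.res (θ : D →* G) X) (N.comap (θ : D →* G)))) :
    ∃ z : continuousCohomology.{u, v, v} 1 (TopRep.res (θ : D →* G) (coindFin X N)),
      ∀ i, cohomologyMap (resCoindFinHomR X N θ (c i)) 1 z =
        shapiroLift (TopRep.res (θ : D →* G) X) (N.comap (θ : D →* G)) (isOpen_comap N θ hN) hsD hsD1 (a i) :=
  exists_eq_cohomologyMap_resCoindFinHomR X N θ c hbij _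

/-- **Compatibility with restriction of GLOBAL classes** (the bridge to (M) §3/§5): the `i`-th Mackey coordinate of the
restriction `θ^* x` of a global class `x ∈ H¹(G, Maps(G⧸N, X))` is `H¹(θ, Φ_{c_i}) x`; for `x = Sh_N^G a` this is
`Sh_{N_D}^D(θ_N^*(g_i · a))` by the landed `map_resCoindFinHomR_shapiroLift`. [cite: NeukirchSchmidtWingberg2008, I §5 (1.5.6)–(1.5.7)] -/
theorem cohomologyMap_resCoindFinHomR_map_id [IsTopologicalGroup G] (x : continuousCohomology.{u, v, v} 1 (coindFin X N)) (i : ι) :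
    cohomologyMap (resCoindFinHomR X N θ (c i)) 1
        (ContinuousCohomology.map θ (𝟙 (TopRep.res (θ : D →* G) (coindFin X N))) 1 x) =
      ContinuousCohomology.map θ (resCoindFinHomR X N θ (c i)) 1 x := by
  obtain ⟨φ, rfl⟩ := oneCocycleClass_surjective _ x
  rw [map_oneCocycleClass, map_oneCocycleClass, map_oneCocycleClass]
  exact congrArg _ (Subtype.ext (ContinuousMap.ext fun d => rfl))

end CohomologyLevel

/-! ## §C The local Mackey cup formula for arbitrary local classes (H-SL3) -/

namespace LocalCup

variable [IsTopologicalGroup G] [IsTopologicalGroup D] [LocallyCompactSpace G] [LocallyCompactSpace D]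
variable {X Y Z : TopRep.{v} R G} (P : ContPairing X Y Z) (N : Subgroup G) [N.Normal] (θ : D →ₜ* G)
  [Fintype (G ⧸ N)] [Fintype (D ⧸ N.comap (θ : D →* G))] {ι : Type v} [Fintype ι] (c : ι → G ⧸ N)
  (hbij : Function.Bijective fun q : ι × (D ⧸ N.comap (θ : D →* G)) => quotientMapOfHom N θ q.2 * c q.1)

omit [IsTopologicalGroup G] [LocallyCompactSpace G] in
include hbij in
/-- **H-SL3 — local Mackey cup formula, ARBITRARY local classes.** For `z ∈ H¹(D, (Maps(G⧸N, X))|_θ)`,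
`z' ∈ H¹(D, (Maps(G⧸N, Y))|_θ)` and the summed pairing `Σ_{G⧸N} P` restricted to `D`:
`z ∪_{(Σ P)|_θ} z' = Σ_i H¹(Φ_{c_i}) z ∪_{Σ_{D⧸N_D} P|_θ} H¹(Φ_{c_i}) z'` in `H²(D, Z|_θ)` — (M) §1 along `id_D` with the
compatibility (M) §4. With `D = Γ_{ℚ_ℓ}`, `P` = the Weil/Cartier pairing, this is the Poitou–Tate LOCAL TERM at `ℓ ∈ S₀`
as the sum over the places `𝔩 ∣ ℓ` of `ℚ_n` of layer brackets (the one-orbit case is the tree's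
`localTatePairing_coind_cohomologyMap_eq_cupProduct_pull`). [cite: NeukirchSchmidtWingberg2008, I §5 Prop. (1.5.3), (1.5.6)] -/
theorem cupProduct_res_coindFin_eq_sum
    (z : continuousCohomology 1 (TopRep.res (θ : D →* G) (coindFin X N)))
    (z' : continuousCohomology 1 (TopRep.res (θ : D →* G) (coindFin Y N))) :
    cohomologyMap (𝟙 (TopRep.res (θ : D →* G) Z)) 2 (((P.coindFin N).restrict θ).cupProduct z z') =
      ∑ i, ((P.restrict θ).coindFin (N.comap (θ : D →* G))).cupProduct
        (cohomologyMap (resCoindFinHomR X N θ (c i)) 1 z) (cohomologyMap (resCoindFinHomR Y N θ (c i)) 1 z') :=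
  ContPairing.cupProduct_mapPair_sum Finset.univ ((P.coindFin N).restrict θ)
    ((P.restrict θ).coindFin (N.comap (θ : D →* G))) (ContinuousMonoidHom.id D)
    (fun i => resIdHom (resCoindFinHomR X N θ (c i))) (fun i => resIdHom (resCoindFinHomR Y N θ (c i)))
    (resIdHom (𝟙 _)) (fun F F' => by
      rw [resIdHom_hom_apply, ContPairing.restrict_toLin]
      exact ContPairing.coindFin_toLin_sum_resCoindFinHomR P N θ c hbij F F') z z'

end LocalCup

/-! ## §D The semi-local COUNT (H-SL4): stated as a `Prop` and proved -/

section Signatures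

variable [IsTopologicalGroup D]
variable (X : TopRep.{v} R G) (N : Subgroup G) [N.Normal] (θ : D →ₜ* G) {ι : Type v} [Fintype ι] (c : ι → G ⧸ N)

/-- **H-SL4 — the semi-local COUNT** `#H¹(D, (Maps(G⧸N, X))|_θ) = ∏_i #H¹(N_D, X|_θ)` for orbit
representatives `c` (from H-SL2′: Mackey + Shapiro; finite when the right side is). Dictionary: Greenberg LNM 1716 §4,
`𝒫^{(v)}(F_n) = ∏_{v_n ∣ v} ℋ((F_n)_{v_n})`; GV2000 §2 `ℋ_ℓ = ∏_{η∣ℓ} H¹((ℚ_∞)_η, ·)` (tree twin of Prop. 2.4: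
`zpCorank_subgroupH1_kerD_eq_ite`). [cite: NeukirchSchmidtWingberg2008, I §5 (1.5.6), I §6 (1.6.4)] -/
def SemiLocalCount : Prop :=
  (Function.Bijective fun q : ι × (D ⧸ N.comap (θ : D →* G)) => quotientMapOfHom N θ q.2 * c q.1) →
    IsOpen (N : Set G) →
      Nat.card (continuousCohomology.{u, v, v} 1 (TopRep.res (θ : D →* G) (coindFin X N))) =
        ∏ _i : ι, Nat.card (continuousCohomology.{u, v, v} 1 (subgroupRep (TopRep.res (θ : D →* G) X) (N.comap (θ : D →* G))))

/-- **H-SL4 PROVED**: the semi-local count holds (Mackey `H¹`-coordinates §B + the degree-one Shapiro bijection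
`shapiroLift_injective/_surjective` per orbit). [cite: NeukirchSchmidtWingberg2008, I §5 (1.5.6), I §6 (1.6.4)] -/
theorem semiLocalCount : SemiLocalCount X N θ c := by
  intro hbij hN
  classical
  let sD : D ⧸ N.comap (θ : D →* G) → D := fun y =>
    if y = ((1 : D) : D ⧸ N.comap (θ : D →* G)) then 1 else Quotient.out y
  have hsD : ∀ y, (sD y : D ⧸ N.comap (θ : D →* G)) = y := fun y => by
    by_cases hy : y = ((1 : D) : D ⧸ N.comap (θ : D →* G))
    · subst hy
      simp only [sD, if_true, QuotientGroup.mk_one]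
    · simp only [sD, if_neg hy]
      exact QuotientGroup.out_eq' y
  have hsD1 : sD ((1 : D) : D ⧸ N.comap (θ : D →* G)) = 1 := by simp only [sD, if_pos rfl]
  rw [Nat.card_congr (mackeyCohomologyEquiv X N θ c hbij).toEquiv, Nat.card_pi]
  refine Finset.prod_congr rfl fun i _ => ?_
  exact (Nat.card_congr (Equiv.ofBijective _
    ⟨shapiroLift_injective (TopRep.res (θ : D →* G) X) (N.comap (θ : D →* G)) (isOpen_comap N θ hN) hsD hsD1,
      shapiroLift_surjective (TopRep.res (θ : D →* G) X) (N.comap (θ : D →* G)) (isOpen_comap N θ hN) hsD hsD1⟩)).symm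

end Signatures

/-! ## §E ARITHMETIC (N3 of card k3-g11, delivered): the MANY-ORBIT local term of Poitou–Tate for `Maps(Γ_K ⧸ U, M)` at a
place `v`, in the currency `localTatePairing` that `SelmerComplement` consumes — the twin of the tree's ONE-orbit
`DiscreteGaloisModule.localTatePairing_coind_cohomologyMap_eq_cupProduct_pull` (`CoinducedDiscreteGaloisModuleProofs` §2) with
`θ̄^* = H¹(coindFinPull)` (one double coset) replaced by the family of Mackey coordinates `H¹(Φ_{c_i})`, `Φ_c = resCoindFinHomR` ((M) §2),
and `(Equiv.ofBijective _ hbij).sum_comp` replaced by (M) §4 `ContPairing.coindFin_toLin_sum_resCoindFinHomR`. -/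

namespace Arith

open Function Field NumberField
open Literature.NumberTheory.GaloisRepresentations.DiscreteGaloisModule

attribute [local instance] absoluteGaloisGroup_compactSpace

variable {K : Type u} [Field K] {M M' : Type u} [AddCommGroup M] [TopologicalSpace M] [DiscreteTopology M]
  [AddCommGroup M'] [TopologicalSpace M'] [DiscreteTopology M'] [Finite M]
  (ρ : DiscreteGaloisModule K M) (ρ' : DiscreteGaloisModule K M')
  (U : Subgroup (absoluteGaloisGroup K)) [U.Normal] [Fintype (absoluteGaloisGroup K ⧸ U)]
  {n : ℕ} (B : M →+ M' →+ MuCarrier K n)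
  (hU : IsOpen (U : Set (absoluteGaloisGroup K)))
  (hB : ∀ (σ : absoluteGaloisGroup K) (m : M) (m' : M'), B (ρ σ m) (ρ' σ m') = mu K n σ (B m m'))

variable [NumberField K] (v : Place K)

/-- **The local Tate pairing of `Maps(Γ_K ⧸ U, M)` at `v`, MANY ORBITS.**  Let `θ = Γ_{K_v} → Γ_K`, `U' = θ⁻¹U`, `ē : Γ_{K_v} ⧸ U' → Γ_K ⧸ U`,
and `c : ι → Γ_K ⧸ U` with `(i, z) ↦ ē(z)·c_i` BIJECTIVE (`{c_i}` = representatives of the `Γ_{K_v}`-orbits on `Γ_K ⧸ U` = the places of the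
fixed field of `U` above `v`).  For a local class `a' ∈ H¹(K_v, Maps(Γ_K ⧸ U, M))` and `t ∈ H¹(Γ_{K_v}, Maps(Γ_K ⧸ U, M')|_θ)`:

  `⟨a', H¹(Ψ_v) t⟩_v = Σ_i  H¹(Φ_{c_i}) a' ∪_{Σ_{U'} B_v} H¹(Φ_{c_i}) t`   in `H²(K_v, μₙ)`,

i.e. the local term of Poitou–Tate for the induced module is the SUM over the places `w_i ∣ v` of the layer-`U'` summed-pairing cup products
of the Mackey coordinates (on cocycles: `Σ_{y ∈ Γ_K⧸U} B(φ y, ψ y) = Σ_i Σ_{z ∈ Γ_{K_v}⧸U'} B(φ(ē z·c_i), ψ(ē z·c_i))`).  With (M) §3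
`map_resCoindFinHomR_shapiroLift` each coordinate of a restricted GLOBAL Shapiro lift `θ^*(Sh_U b)` is the local Shapiro lift of the conjugated
layer localisation `θ_U^*(g_i·b)`, so each summand is the tree's LAYER pairing in the Shapiro model (`…LayerPairingModDefs`:
`⟨x, y⟩_{n} = inv_v(Sh(x) ∪_{Σ} Sh(y))`) at the place `w_i`.  Literature: the semi-local decomposition
`H¹(K_v, Ind M) = ⊕_{w∣v} H¹(L_w, M)` compatible with the local pairings (Milne ADT I, proof of Prop. 6.9 / Cor. 2.3; NSW (7.1.?) via (1.5.3)(iv),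
(1.6.4)–(1.6.5); Greenberg LNM 1716 §4 `𝒫^{(v)}(F_n) = ∏_{v_n∣v} ℋ((F_n)_{v_n})`). [cite: NeukirchSchmidtWingberg2008, I §5 Prop. (1.5.3)(iv), I §6 (1.6.5)]
[cite: MilneADT2006, Ch. I Cor. 2.3] [cite: Brown1982, III §5 (5.6)(b)] -/
theorem localTatePairing_coind_eq_sum_cupProduct_resCoindFinHomR
    [Fintype (absoluteGaloisGroup (Place.Completion v) ⧸
      U.comap (absGaloisRestrict K (Place.Completion v) : absoluteGaloisGroup (Place.Completion v) →* absoluteGaloisGroup K))]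
    {ι : Type*} [Fintype ι] (c : ι → absoluteGaloisGroup K ⧸ U)
    (hbij : Bijective fun q : ι × (absoluteGaloisGroup (Place.Completion v) ⧸
        U.comap (absGaloisRestrict K (Place.Completion v) : absoluteGaloisGroup (Place.Completion v) →* absoluteGaloisGroup K)) =>
        quotientMapOfHom U (absGaloisRestrict K (Place.Completion v)) q.2 * c q.1)
    (a' : continuousCohomology.{0, u, u} 1
      (TopRep.res (absGaloisRestrict K (Place.Completion v) : absoluteGaloisGroup (Place.Completion v) →* absoluteGaloisGroup K)
        (coindFin.{0, u} ρ.toTopRep U)))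
    (t : continuousCohomology.{0, u, u} 1
      (TopRep.res (absGaloisRestrict K (Place.Completion v) : absoluteGaloisGroup (Place.Completion v) →* absoluteGaloisGroup K)
        (coindFin.{0, u} ρ'.toTopRep U))) :
    localTatePairing (ρ.coind U hU) n v a'
        (cohomologyMap (TopRep.ofHom ⟨(coindTateDualMor ρ ρ' U B hU hB).hom.toContinuousLinearMap, fun d =>
            (coindTateDualMor ρ ρ' U B hU hB).hom.isIntertwining' (absGaloisRestrict K (Place.Completion v) d)⟩ :
          TopRep.res (absGaloisRestrict K (Place.Completion v) : absoluteGaloisGroup (Place.Completion v) →* absoluteGaloisGroup K)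
              (coindFin.{0, u} ρ'.toTopRep U) ⟶
            (((ρ.coind U hU).tateDual n).toLocal v).toTopRep) 1 t) =
      ∑ i, ((pairing (ρ.toLocal v) (ρ'.toLocal v) ((mu K n).toLocal v) B fun σ m m' =>
            hB (absGaloisRestrict K (Place.Completion v) σ) m m').coindFin
            (U.comap (absGaloisRestrict K (Place.Completion v) :
              absoluteGaloisGroup (Place.Completion v) →* absoluteGaloisGroup K))).cupProduct
        (cohomologyMap
          (resCoindFinHomR ρ.toTopRep U (absGaloisRestrict K (Place.Completion v)) (c i) ≫
            coindFinMap (TopRep.ofHom ⟨ContinuousLinearMap.id ℤ M, fun _ => rfl⟩ :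
              TopRep.res (absGaloisRestrict K (Place.Completion v) : absoluteGaloisGroup (Place.Completion v) →* absoluteGaloisGroup K)
                ρ.toTopRep ⟶ (ρ.toLocal v).toTopRep)
              (U.comap (absGaloisRestrict K (Place.Completion v) :
                absoluteGaloisGroup (Place.Completion v) →* absoluteGaloisGroup K))) 1 a')
        (cohomologyMap
          (resCoindFinHomR ρ'.toTopRep U (absGaloisRestrict K (Place.Completion v)) (c i) ≫
            coindFinMap (TopRep.ofHom ⟨ContinuousLinearMap.id ℤ M', fun _ => rfl⟩ :
              TopRep.res (absGaloisRestrict K (Place.Completion v) : absoluteGaloisGroup (Place.Completion v) →* absoluteGaloisGroup K)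
                ρ'.toTopRep ⟶ (ρ'.toLocal v).toTopRep)
              (U.comap (absGaloisRestrict K (Place.Completion v) :
                absoluteGaloisGroup (Place.Completion v) →* absoluteGaloisGroup K))) 1 t) := by
  obtain ⟨f, rfl⟩ := oneCocycleClass_surjective _ a'
  obtain ⟨g, rfl⟩ := oneCocycleClass_surjective _ t
  simp only [cohomologyMap_oneCocycleClass, ContPairing.cupProduct_oneCocycleClass_eq_twoCocycleClass]
  erw [localTatePairing_oneCocycleClass, ContPairing.cupClass_eq_twoCocycleClass]
  simp only [← twoCocycleClassₗ_apply, ← map_sum]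
  congr 1
  refine Subtype.ext (ContinuousMap.ext fun p => ?_)
  obtain ⟨σ, τ⟩ := p
  rw [Submodule.coe_sum, ContinuousMap.sum_apply, ContPairing.cupCocycle_apply]
  repeat rw [pullback_id_resIdHom_apply]
  rw [map_sub]
  trans ∑ i,
    (((pairing (ρ.toLocal v) (ρ'.toLocal v) ((mu K n).toLocal v) B fun σ m m' =>
            hB (absGaloisRestrict K (Place.Completion v) σ) m m').coindFin
            (U.comap (absGaloisRestrict K (Place.Completion v) :
              absoluteGaloisGroup (Place.Completion v) →* absoluteGaloisGroup K))).toLin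
        ((resCoindFinHomR ρ.toTopRep U (absGaloisRestrict K (Place.Completion v)) (c i) ≫
            coindFinMap (TopRep.ofHom ⟨ContinuousLinearMap.id ℤ M, fun _ => rfl⟩ :
              TopRep.res (absGaloisRestrict K (Place.Completion v) : absoluteGaloisGroup (Place.Completion v) →* absoluteGaloisGroup K)
                ρ.toTopRep ⟶ (ρ.toLocal v).toTopRep)
              (U.comap (absGaloisRestrict K (Place.Completion v) :
                absoluteGaloisGroup (Place.Completion v) →* absoluteGaloisGroup K))).hom (f.1 σ))
        ((resCoindFinHomR ρ'.toTopRep U (absGaloisRestrict K (Place.Completion v)) (c i) ≫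
            coindFinMap (TopRep.ofHom ⟨ContinuousLinearMap.id ℤ M', fun _ => rfl⟩ :
              TopRep.res (absGaloisRestrict K (Place.Completion v) : absoluteGaloisGroup (Place.Completion v) →* absoluteGaloisGroup K)
                ρ'.toTopRep ⟶ (ρ'.toLocal v).toTopRep)
              (U.comap (absGaloisRestrict K (Place.Completion v) :
                absoluteGaloisGroup (Place.Completion v) →* absoluteGaloisGroup K))).hom (g.1 (σ * τ))) -
      ((pairing (ρ.toLocal v) (ρ'.toLocal v) ((mu K n).toLocal v) B fun σ m m' =>
            hB (absGaloisRestrict K (Place.Completion v) σ) m m').coindFin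
            (U.comap (absGaloisRestrict K (Place.Completion v) :
              absoluteGaloisGroup (Place.Completion v) →* absoluteGaloisGroup K))).toLin
        ((resCoindFinHomR ρ.toTopRep U (absGaloisRestrict K (Place.Completion v)) (c i) ≫
            coindFinMap (TopRep.ofHom ⟨ContinuousLinearMap.id ℤ M, fun _ => rfl⟩ :
              TopRep.res (absGaloisRestrict K (Place.Completion v) : absoluteGaloisGroup (Place.Completion v) →* absoluteGaloisGroup K)
                ρ.toTopRep ⟶ (ρ.toLocal v).toTopRep)
              (U.comap (absGaloisRestrict K (Place.Completion v) :
                absoluteGaloisGroup (Place.Completion v) →* absoluteGaloisGroup K))).hom (f.1 σ))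
        ((resCoindFinHomR ρ'.toTopRep U (absGaloisRestrict K (Place.Completion v)) (c i) ≫
            coindFinMap (TopRep.ofHom ⟨ContinuousLinearMap.id ℤ M', fun _ => rfl⟩ :
              TopRep.res (absGaloisRestrict K (Place.Completion v) : absoluteGaloisGroup (Place.Completion v) →* absoluteGaloisGroup K)
                ρ'.toTopRep ⟶ (ρ'.toLocal v).toTopRep)
              (U.comap (absGaloisRestrict K (Place.Completion v) :
                absoluteGaloisGroup (Place.Completion v) →* absoluteGaloisGroup K))).hom (g.1 σ)))
  · rw [Finset.sum_sub_distrib]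
    refine congrArg₂ (· - ·) ?_ ?_ <;>
    · change ((pairing ρ ρ' (mu K n) B hB).coindFin U).toLin (f.1 σ) (g.1 _) = _
      rw [ContPairing.coindFin_toLin_sum_resCoindFinHomR (pairing ρ ρ' (mu K n) B hB) U
        (absGaloisRestrict K (Place.Completion v)) c hbij]
      refine Finset.sum_congr rfl fun i _ => ?_
      rfl
  · refine Finset.sum_congr rfl fun i _ => ?_
    rw [ContPairing.cupCocycle_apply]
    repeat rw [pullback_id_resIdHom_apply]
    rw [map_sub]

end Arith

/-! ## §F (N1 of card k3-g11, delivered): orbit representatives give `hbij`, they exist, and `#ι · [D : θ⁻¹N] = [G : N]` -/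

section OrbitReps

variable (N : Subgroup G) [N.Normal] (θ : D →ₜ* G)

/-- **`hbij` from orbit representatives**: if every coset `y ∈ G ⧸ N` is `θ(d)·c_i` for some `i`, `d` (`hcov`) and `θ(D)·c_i ∋ c_j ⇒ i = j`
(`hsep`), then `(i, z) ↦ ē(z)·c_i : ι × D ⧸ θ⁻¹N → G ⧸ N` is bijective (injectivity in `z`: the stabiliser of every `c_i` in `D` is `θ⁻¹N`
because `N` is normal; `ē` injective = `quotientMapOfHom_injective`).  Arithmetic reading: `ι` = places of the fixed field of `N` above the
place of `θ`, `D ⧸ θ⁻¹N` = the local Galois group of the layer. [cite: Brown1982, III §5 (5.6)(b)] [cite: NeukirchSchmidtWingberg2008, I §6 (1.6.5)] -/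
theorem bijective_of_orbitReps {ι : Type*} (c : ι → G ⧸ N)
    (hcov : ∀ y : G ⧸ N, ∃ i, ∃ d : D, y = ((θ d : G) : G ⧸ N) * c i)
    (hsep : ∀ i j (d : D), ((θ d : G) : G ⧸ N) * c i = c j → i = j) :
    Function.Bijective fun q : ι × (D ⧸ N.comap (θ : D →* G)) => quotientMapOfHom N θ q.2 * c q.1 := by
  constructor
  · rintro ⟨i, y⟩ ⟨j, y'⟩ h
    induction y using QuotientGroup.induction_on with
    | H a =>
      induction y' using QuotientGroup.induction_on with
      | H b =>
        simp only [quotientMapOfHom_mk] at h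
        have hij : i = j := by
          refine hsep i j (b⁻¹ * a) ?_
          rw [map_mul, map_inv, QuotientGroup.mk_mul, QuotientGroup.mk_inv, mul_assoc, h, inv_mul_cancel_left]
        subst hij
        have hab : ((θ a : G) : G ⧸ N) = ((θ b : G) : G ⧸ N) := mul_right_cancel h
        have hq : (a : D ⧸ N.comap (θ : D →* G)) = (b : D ⧸ N.comap (θ : D →* G)) :=
          quotientMapOfHom_injective N θ (by rw [quotientMapOfHom_mk, quotientMapOfHom_mk]; exact hab)
        rw [hq]
  · intro y
    obtain ⟨i, d, h⟩ := hcov y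
    refine ⟨(i, (d : D ⧸ N.comap (θ : D →* G))), ?_⟩
    change quotientMapOfHom N θ (d : D ⧸ N.comap (θ : D →* G)) * c i = y
    rw [quotientMapOfHom_mk]
    exact h.symm

/-- The `D`-orbit relation on `G ⧸ N` through `θ`, `y ∼ y' :⟺ ∃ d, y' = θ(d)·y`, is an equivalence relation. [cite: Brown1982, III §5 (5.6)(b)] -/
theorem orbitRel_equivalence :
    Equivalence fun y y' : G ⧸ N => ∃ d : D, y' = ((θ d : G) : G ⧸ N) * y := by
  refine ⟨fun y => ⟨1, by rw [map_one, QuotientGroup.mk_one, one_mul]⟩, ?_, ?_⟩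
  · rintro y y' ⟨d, h⟩
    exact ⟨d⁻¹, by rw [h, map_inv, QuotientGroup.mk_inv, inv_mul_cancel_left]⟩
  · rintro y y' y'' ⟨d, h⟩ ⟨d', h'⟩
    exact ⟨d' * d, by rw [h', h, map_mul, QuotientGroup.mk_mul, mul_assoc]⟩

/-- **Orbit representatives exist** (`ι :=` the `D`-orbits of `G ⧸ N`, `c := Quotient.out`): there are a finite type `ι` (in the universe
of `G`, as the Mackey `H¹` coordinates of §B require) and `c : ι → G ⧸ N` with `hbij`. [cite: Brown1982, III §5 (5.6)(b)] -/
theorem exists_orbitReps [Finite (G ⧸ N)] :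
    ∃ (ι : Type v) (_ : Fintype ι) (c : ι → G ⧸ N),
      Function.Bijective fun q : ι × (D ⧸ N.comap (θ : D →* G)) => quotientMapOfHom N θ q.2 * c q.1 := by
  classical
  let S : Setoid (G ⧸ N) := ⟨fun y y' => ∃ d : D, y' = ((θ d : G) : G ⧸ N) * y, orbitRel_equivalence N θ⟩
  haveI : Finite (Quotient S) := Quotient.finite S
  refine ⟨Quotient S, Fintype.ofFinite _, fun i => i.out, bijective_of_orbitReps N θ _ ?_ ?_⟩
  · intro y
    obtain ⟨d, hd⟩ : S (Quotient.mk S y).out y := Quotient.exact (Quotient.out_eq (Quotient.mk S y))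
    exact ⟨Quotient.mk S y, d, hd⟩
  · intro i j d h
    have hS : S i.out j.out := ⟨d, h.symm⟩
    rw [← Quotient.out_eq i, ← Quotient.out_eq j]
    exact Quotient.sound hS

/-- **Q68 of STUB-PLAN rev 16, verbatim shape** (`g : ι → G`, as the `hbij` binder of the tree's `resCoindFinHomR_jointly_bijective`,
`exists_cohomologyMap_resCoindFinHomR_eq`, `cupProduct_map_shapiroLift_eq_sum_orbits` (p685176) and of
`CyclotomicLayer.invAt_localization_cupProduct_shapiroLift_eq_sum` (p685345) is spelled): representatives IN `G` exist. -/
theorem exists_orbitReps_bijective [Finite (G ⧸ N)] :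
    ∃ (ι : Type v) (_ : Fintype ι) (g : ι → G),
      Function.Bijective fun q : ι × (D ⧸ N.comap (θ : D →* G)) => quotientMapOfHom N θ q.2 * (g q.1 : G ⧸ N) := by
  obtain ⟨ι, hι, c, hc⟩ := exists_orbitReps N θ
  refine ⟨ι, hι, fun i => Quotient.out (c i), ?_⟩
  have h : (fun q : ι × (D ⧸ N.comap (θ : D →* G)) => quotientMapOfHom N θ q.2 * ((Quotient.out (c q.1) : G) : G ⧸ N)) =
      fun q => quotientMapOfHom N θ q.2 * c q.1 := by
    funext q; rw [QuotientGroup.out_eq']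
  rw [h]; exact hc

/-- `#ι · [D : θ⁻¹N] = [G : N]` — arithmetic reading `Σ_{w∣v} [L_w : K_v] = [L : K]` for the Galois layer `L = ` fixed field of `N`
(all local degrees equal). [cite: NeukirchSchmidtWingberg2008, I §6 (1.6.5)] -/
theorem card_mul_index_eq_of_orbitReps {ι : Type*} [Fintype ι] [Fintype (G ⧸ N)] [Fintype (D ⧸ N.comap (θ : D →* G))]
    (c : ι → G ⧸ N)
    (hbij : Function.Bijective fun q : ι × (D ⧸ N.comap (θ : D →* G)) => quotientMapOfHom N θ q.2 * c q.1) :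
    Fintype.card ι * Fintype.card (D ⧸ N.comap (θ : D →* G)) = Fintype.card (G ⧸ N) := by
  rw [← Fintype.card_prod]
  exact Fintype.card_congr (Equiv.ofBijective _ hbij)

end OrbitReps

end Summit.BirchSwinnertonDyer.BirchSwinnertonDyer.Cruxes.ResidualThetaCountLowerPureAtTwo.SideaK2G12

end
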